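import Literature.Analysis.OperatorTheory.YangMillsMatrixModelValleyBound
import Literature.Analysis.OperatorTheory.YangMillsMatrixModelLevels
import Literature.Analysis.PDE.MollifierRate
import Mathlib.Analysis.Calculus.BumpFunction.InnerProduct
import Mathlib.Analysis.Calculus.BumpFunction.Normed
import Mathlib.Analysis.Calculus.Deriv.Mul
import Mathlib.Analysis.Convolution
import Mathlib.Analysis.InnerProductSpace.PiL2
import Mathlib.MeasureTheory.Integral.IntervalIntegral.FundThmCalculus
import Mathlib.MeasureTheory.Integral.Prod
import Mathlib.MeasureTheory.Measure.Haar.Unique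
import HarnessLib

/-!
# Lüscher's Yang–Mills matrix model: the invariant-sector spectrum is discrete (`μ_k → ∞`)

Topic `Literature/Analysis/OperatorTheory` — third companion of
`YangMillsMatrixModelDiscreteSpectrum.lean` (vocabulary: `ZM = ℝ⁹`, `energyForm` = the quadratic form
`𝔮` of `𝔥 = −½Δ + V`, `l2sq`, `IsTestFn`, `IsGaugeInv`, the min–max levels `physLevel`, the named
fact `LuscherSimonGap = (Tendsto physLevel atTop atTop ∧ 0 < luscherEps1)`), after
`…ValleyBound.lean` (Simon's zero-point bound `𝔮(ψ) ≥ ⅔ ∫‖x‖ψ²`) and `…Levels.lean` (the level sets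
`levelSet k` are non-empty and bounded below, `physLevel k = inf levelSet k`).

**Main result** (`tendsto_physLevel_atTop`): `μ_k^inv → ∞` — the COMPACTNESS half of
`LuscherSimonGap`, i.e. B. Simon, *Ann. Phys.* **146** (1983) 209–220, Corollary 4 ("`H₃ = −Δ +
Σ_{α<β}(x_α × x_β)²` has discrete spectrum") for `𝔞 = su(2)`, `ν = 3` (Lüscher, *Nucl. Phys.*
**B219** (1983) 233–261, §1), in min–max form and restricted to the colour-rotation-invariant trial
space of the tree.  Consequently `LuscherSimonGap ↔ 0 < luscherEps1` (`luscherSimonGap_iff_eps1_pos`):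
the named fact is reduced to the simplicity of the invariant ground level.

**Proof** (Simon: zero-point bound ⇒ `𝔮 ≥ ⅔|x| − C`, "so `H` has compact resolvent by Rellich";
here Rellich's criterion, Reed–Simon IV Thm. XIII.64, is replaced by an explicit dimension count, so
that everything stays inside `C²_c` trial functions and Bochner integrals):

* §A `finrank_le_of_pointwise_of_weight` — a finite-dimensional space `V ⊂ L²(ℝ⁹)` with a pointwise
  bound `φ(x)² ≤ A‖φ‖²` and a weight bound `∫‖x‖φ² ≤ T‖φ‖²` has `dim V ≤ 2A·vol B(0,2T)`: for an
  `L²`-orthonormal basis `e_i` of `V`, `Σ_i e_i(x)² ≤ A` (test the pointwise bound on `Σ e_i(x)e_i`) and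
  each `e_i` has at least half its mass in `B(0,2T)`, so `n = Σ‖e_i‖² ≤ A vol(B) + n/2`
  (the trace count behind Grothendieck's `L^∞ ⊂ L²` finiteness theorem).
* §B mollification `A_ρψ = ρ ⋆ ψ` by a normed bump `ρ` of radius `δ` (Brezis, *Functional Analysis*,
  §4.4 and the proof of Thm. 4.26 (Kolmogorov–M. Riesz–Fréchet)): pointwise bound
  `(A_ρψ)(x)² ≤ ρ_max‖ψ‖²` (Step 2 there), the translation estimate
  `‖ψ(·−t) − ψ‖₂ ≤ |t| ‖∇ψ‖₂` (Brezis Prop. 9.3, same proof: FTC along the segment, Jensen, Fubini,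
  translation invariance) and hence `‖A_ρψ − ψ‖₂² ≤ δ²‖∇ψ‖₂²` (Step 1 there), and the weight bound
  `∫‖x‖(A_ρψ)² ≤ ∫‖x‖ψ² + δ‖ψ‖²`.  (`Literature/Analysis/PDE/MollifierRate.lean` has the translation and
  mollification rates in `eLpNorm` form with the constant `Σⱼ‖∂ⱼh‖₂` for vector-valued `h`; §B states
  the two inequalities in the Bochner-integral / `gradient` form that `energyForm` uses — `∫‖∇ψ‖²`
  is `2 ×` the kinetic part of `𝔮` — and reuses that file's Cauchy–Schwarz on `[0,1]`.)
* §C for a space `W` of trial functions with Rayleigh quotient `≤ E`: `‖∇ψ‖₂² ≤ 2E‖ψ‖²` (`V ≥ 0`) and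
  `∫‖x‖ψ² ≤ (3/2)E‖ψ‖²` (valley bound); with `δ = 1/(2(√(2E)+1))` the mollifier is injective on `W`
  (`‖ψ‖² ≤ 4‖A_ρψ‖²`), so `dim W = dim A_ρ(W) ≤ N(E) := 8ρ_max · vol B(0, 2(6E+4δ))`
  (`finrank_le_dimBound`); hence `k > N(E) ⇒ μ_k ≥ E` (`le_physLevel_of_dimBound_lt`) and
  `μ_k → ∞`.

All statements are theorems (no new named facts); the remaining content of `LuscherSimonGap` is
`0 < luscherEps1` (ground-state existence + Perron–Frobenius in the invariant sector).

## References
* [SimonB1983DiscreteSpectrum] B. Simon, *Some quantum operators with discrete spectrum but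
  classically continuous spectrum*, Ann. Phys. 146 (1983) 209–220 — §2 eq. (5), Cor. 4.
* [Luscher1983] M. Lüscher, *Some analytic results concerning the mass spectrum of Yang–Mills gauge
  theories on a torus*, Nucl. Phys. B219 (1983) 233–261 — §1.
* [ReedSimonIV1978] M. Reed, B. Simon, *Methods of Modern Mathematical Physics IV*, Thm. XIII.1–2
  (min–max), Thm. XIII.64 (compact resolvent ⇔ `μ_n → ∞`).
* [Brezis2011] H. Brezis, *Functional Analysis, Sobolev Spaces and PDE*, Springer 2011 — §4.4,
  Thm. 4.26 (proof, Steps 1–2), Prop. 9.3.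
-/

noncomputable section

open Matrix MeasureTheory Filter Topology
open scoped BigOperators RealInnerProductSpace

namespace Literature.Analysis.OperatorTheory.YMMatrixModel

/-! ### A. Finite dimension from a pointwise bound and a linear weight bound -/

section Trace

/-- `|ab| ≤ (a² + b²)/2`. [folklore] -/
private theorem abs_mul_le_half_add_sq (a b : ℝ) : |a * b| ≤ (a ^ 2 + b ^ 2) / 2 := by
  rw [abs_mul]
  nlinarith [sq_nonneg (|a| - |b|), sq_abs a, sq_abs b, abs_nonneg a, abs_nonneg b]

/-- Products of square-integrable (a.e. strongly measurable) functions are integrable. [folklore] -/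
private theorem integrable_mul_of_sq {φ ψ : ZM → ℝ} (hφm : AEStronglyMeasurable φ volume)
    (hψm : AEStronglyMeasurable ψ volume) (hφ : Integrable fun x => φ x ^ 2)
    (hψ : Integrable fun x => ψ x ^ 2) : Integrable fun x => φ x * ψ x := by
  refine Integrable.mono' ((hφ.add hψ).div_const 2) (hφm.mul hψm) (Eventually.of_forall fun x => ?_)
  rw [Real.norm_eq_abs]
  exact abs_mul_le_half_add_sq (φ x) (ψ x)

/-- **Finite dimension by the trace argument.**  Let `V` be a finite-dimensional space of
square-integrable functions on `ℝ⁹` on which `φ ↦ ∫ φ²` is definite, with a uniform POINTWISE bound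
`φ(x)² ≤ A ∫φ²` and a linear WEIGHT bound `∫ ‖x‖ φ² ≤ T ∫ φ²` (`T > 0`).  Then
`dim V ≤ 2 A · vol(B(0, 2T))`.  Proof: for an `L²`-orthonormal basis `e₁, …, e_n` of `V` the kernel
`K(x) = Σ e_i(x)²` satisfies `K ≤ A` pointwise (test the pointwise bound on `φ = Σ e_i(x) e_i`), each
`e_i` has at most half of its mass outside `B(0,2T)` (weight bound), so
`n = Σ ∫ e_i² ≤ ∫_B K + n/2 ≤ A vol(B) + n/2` (the trace count of Grothendieck's finiteness theorem
for `L^∞`-bounded subspaces of `L²`; it replaces Rellich's criterion). [cite: ReedSimonIV1978, Thm. XIII.64] -/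
theorem finrank_le_of_pointwise_of_weight (V : Submodule ℝ (ZM → ℝ)) [FiniteDimensional ℝ V]
    (hmeas : ∀ φ ∈ V, AEStronglyMeasurable φ volume)
    (hsq : ∀ φ ∈ V, Integrable fun x => φ x ^ 2)
    (hw : ∀ φ ∈ V, Integrable fun x => ‖x‖ * φ x ^ 2)
    (hdef : ∀ φ ∈ V, ∫ x, φ x ^ 2 = 0 → φ = 0)
    {A T : ℝ} (hA : 0 ≤ A) (hT : 0 < T)
    (hpt : ∀ φ ∈ V, ∀ x, φ x ^ 2 ≤ A * ∫ y, φ y ^ 2)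
    (hwt : ∀ φ ∈ V, ∫ x, ‖x‖ * φ x ^ 2 ≤ T * ∫ x, φ x ^ 2) :
    (Module.finrank ℝ V : ℝ) ≤ 2 * A * (volume (Metric.closedBall (0 : ZM) (2 * T))).toReal := by
  classical
  -- the `L²` inner product on `V`
  have hmul : ∀ φ ψ : V, Integrable fun x => (φ : ZM → ℝ) x * (ψ : ZM → ℝ) x := fun φ ψ =>
    integrable_mul_of_sq (hmeas _ φ.2) (hmeas _ ψ.2) (hsq _ φ.2) (hsq _ ψ.2)
  let core : InnerProductSpace.Core ℝ V :=
    { inner := fun φ ψ => ∫ x, (φ : ZM → ℝ) x * (ψ : ZM → ℝ) x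
      conj_inner_symm := fun φ ψ => by
        simp only [conj_trivial]
        exact integral_congr_ae (Eventually.of_forall fun x => mul_comm _ _)
      re_inner_nonneg := fun φ => by
        simp only [RCLike.re_to_real]
        exact integral_nonneg fun x => mul_self_nonneg _
      add_left := fun φ ψ χ => by
        simp only [Submodule.coe_add, Pi.add_apply, add_mul]
        exact integral_add (hmul φ χ) (hmul ψ χ)
      smul_left := fun φ ψ r => by
        simp only [Submodule.coe_smul, Pi.smul_apply, smul_eq_mul, conj_trivial, mul_assoc]
        exact integral_const_mul _ _
      definite := fun φ h => by
        have h' : ∫ x, (φ : ZM → ℝ) x ^ 2 = 0 := by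
          simpa only [sq] using h
        exact Subtype.ext (hdef _ φ.2 h') }
  letI : NormedAddCommGroup V := @InnerProductSpace.Core.toNormedAddCommGroup ℝ V _ _ _ core
  letI : InnerProductSpace ℝ V := InnerProductSpace.ofCore _
  have inner_eq : ∀ φ ψ : V, ⟪φ, ψ⟫ = ∫ x, (φ : ZM → ℝ) x * (ψ : ZM → ℝ) x := fun _ _ => rfl
  have norm_sq_eq : ∀ φ : V, ‖φ‖ ^ 2 = ∫ x, (φ : ZM → ℝ) x ^ 2 := fun φ => by
    rw [← real_inner_self_eq_norm_sq, inner_eq]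
    simp only [sq]
  -- an orthonormal basis
  set n := Module.finrank ℝ V with hn
  let b : OrthonormalBasis (Fin n) ℝ V := stdOrthonormalBasis ℝ V
  let e : Fin n → ZM → ℝ := fun i => (b i : ZM → ℝ)
  have he_mem : ∀ i, e i ∈ V := fun i => (b i).2
  have horth : ∀ i j, ∫ x, e i x * e j x = if i = j then (1 : ℝ) else 0 := fun i j => by
    rw [← inner_eq]
    exact orthonormal_iff_ite.1 b.orthonormal i j
  have hnorm1 : ∀ i, ∫ x, e i x ^ 2 = 1 := fun i => by
    have := horth i i
    simp only [if_true, sq] at this ⊢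
    simpa [sq] using this
  -- the kernel on the diagonal is bounded by `A`
  have hK : ∀ x, ∑ i, e i x ^ 2 ≤ A := by
    intro x
    set c : Fin n → ℝ := fun i => e i x with hc
    let φ : V := ∑ i, c i • b i
    have hφx : (φ : ZM → ℝ) x = ∑ i, c i ^ 2 := by
      simp only [φ, Submodule.coe_sum, Submodule.coe_smul, Finset.sum_apply, Pi.smul_apply,
        smul_eq_mul, sq]
      rfl
    have hφn : ∫ y, (φ : ZM → ℝ) y ^ 2 = ∑ i, c i ^ 2 := by
      rw [← norm_sq_eq, ← real_inner_self_eq_norm_sq]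
      rw [b.orthonormal.inner_sum c c Finset.univ]
      simp [sq]
    have h := hpt _ φ.2 x
    rw [hφx, hφn] at h
    have hS : 0 ≤ ∑ i, c i ^ 2 := Finset.sum_nonneg fun i _ => sq_nonneg _
    by_cases h0 : ∑ i, c i ^ 2 = 0
    · rw [show (∑ i, e i x ^ 2) = ∑ i, c i ^ 2 from rfl, h0]
      exact hA
    · have hpos : 0 < ∑ i, c i ^ 2 := lt_of_le_of_ne hS (Ne.symm h0)
      have : (∑ i, c i ^ 2) * (∑ i, c i ^ 2) ≤ A * ∑ i, c i ^ 2 := by nlinarith [h]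
      exact le_of_mul_le_mul_right this hpos
  -- mass inside / outside the ball `B = closedBall 0 (2T)`
  set B : Set ZM := Metric.closedBall (0 : ZM) (2 * T) with hB
  have hBm : MeasurableSet B := Metric.isClosed_closedBall.measurableSet
  have hBfin : volume B < ⊤ := measure_closedBall_lt_top
  have hin : ∑ i, ∫ x in B, e i x ^ 2 ≤ A * (volume B).toReal := by
    rw [← integral_finsetSum _ (fun i _ => (hsq _ (he_mem i)).integrableOn)]
    calc ∫ x in B, ∑ i, e i x ^ 2 ≤ ∫ x in B, A := by
          refine setIntegral_mono_on (integrable_finsetSum _ fun i _ => (hsq _ (he_mem i)).integrableOn)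
            (integrableOn_const hBfin.ne) hBm fun x _ => hK x
      _ = A * (volume B).toReal := by
          rw [setIntegral_const, smul_eq_mul, mul_comm]
          rfl
  have hout : ∀ i, ∫ x in Bᶜ, e i x ^ 2 ≤ 1 / 2 := by
    intro i
    have h2T : 0 < 2 * T := by linarith
    have h1 : ∫ x in Bᶜ, e i x ^ 2 ≤ ∫ x in Bᶜ, (1 / (2 * T)) * (‖x‖ * e i x ^ 2) := by
      refine setIntegral_mono_on (hsq _ (he_mem i)).integrableOn
        (((hw _ (he_mem i)).const_mul _).integrableOn) hBm.compl fun x hx => ?_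
      rw [hB, Set.mem_compl_iff, Metric.mem_closedBall, dist_zero_right, not_le] at hx
      have hge : (1 : ℝ) ≤ 1 / (2 * T) * ‖x‖ := by
        rw [one_div, ← div_eq_inv_mul, le_div_iff₀ h2T]
        linarith
      calc e i x ^ 2 = 1 * e i x ^ 2 := by ring
        _ ≤ (1 / (2 * T) * ‖x‖) * e i x ^ 2 := mul_le_mul_of_nonneg_right hge (sq_nonneg _)
        _ = 1 / (2 * T) * (‖x‖ * e i x ^ 2) := by ring
    have h2 : ∫ x in Bᶜ, (1 / (2 * T)) * (‖x‖ * e i x ^ 2) ≤ (1 / (2 * T)) * (T * ∫ x, e i x ^ 2) := by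
      rw [integral_const_mul]
      refine mul_le_mul_of_nonneg_left ?_ (by positivity)
      exact (setIntegral_le_integral (hw _ (he_mem i))
        (Eventually.of_forall fun x => mul_nonneg (norm_nonneg _) (sq_nonneg _))).trans (hwt _ (he_mem i))
    have h3 : (1 / (2 * T)) * (T * ∫ x, e i x ^ 2) = 1 / 2 := by
      rw [hnorm1 i]
      field_simp
    linarith
  -- the trace count
  have hcount : (n : ℝ) = ∑ i : Fin n, ∫ x, e i x ^ 2 := by
    simp only [hnorm1, Finset.sum_const, Finset.card_univ, Fintype.card_fin, nsmul_eq_mul, mul_one]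
  have hsplit : ∑ i : Fin n, ∫ x, e i x ^ 2 =
      (∑ i, ∫ x in B, e i x ^ 2) + ∑ i, ∫ x in Bᶜ, e i x ^ 2 := by
    rw [← Finset.sum_add_distrib]
    exact Finset.sum_congr rfl fun i _ => (integral_add_compl hBm (hsq _ (he_mem i))).symm
  have hout' : ∑ i : Fin n, ∫ x in Bᶜ, e i x ^ 2 ≤ (n : ℝ) * (1 / 2) := by
    calc ∑ i : Fin n, ∫ x in Bᶜ, e i x ^ 2 ≤ ∑ _i : Fin n, (1 / 2 : ℝ) := Finset.sum_le_sum fun i _ => hout i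
      _ = (n : ℝ) * (1 / 2) := by
        simp only [Finset.sum_const, Finset.card_univ, Fintype.card_fin, nsmul_eq_mul]
  have hfinal := add_le_add hin hout'
  linarith

end Trace


/-! ### B. Mollification: pointwise bound, weight bound, and `‖ρ⋆ψ − ψ‖₂ ≤ δ ‖∇ψ‖₂` -/

section Mollify

open ContinuousLinearMap in
/-- The mollification `(A_ρ ψ)(x) = ∫ ρ(t) ψ(x − t) dt` (= `ρ ⋆ ψ`). [cite: Brezis2011, §4.4] -/
def mollify (ρ ψ : ZM → ℝ) (x : ZM) : ℝ := ∫ t, ρ t * ψ (x - t)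

/-- Lebesgue measure on `ℝ⁹` is invariant under `x ↦ −x`. [folklore] -/
private theorem volume_isNegInvariant : (volume : Measure ZM).IsNegInvariant :=
  Measure.IsAddHaarMeasure.isNegInvariant_of_regular _

/-- `mollify ρ ψ` is Mathlib's convolution `ρ ⋆ ψ`. [cite: Brezis2011, §4.4] -/
theorem mollify_eq_convolution (ρ ψ : ZM → ℝ) :
    mollify ρ ψ = MeasureTheory.convolution ρ ψ (ContinuousLinearMap.lsmul ℝ ℝ) volume := by
  funext x
  rw [convolution_def]
  simp [mollify, ContinuousLinearMap.lsmul_apply]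

variable {ρ : ZM → ℝ} {ψ : ZM → ℝ}

/-- The mollification integrand is integrable (continuous kernel with compact support).
[cite: Brezis2011, Prop. 4.19] -/
theorem integrable_mollifyIntegrand (hρc : Continuous ρ) (hρs : HasCompactSupport ρ)
    (hψ : Continuous ψ) (x : ZM) : Integrable fun t => ρ t * ψ (x - t) :=
  (hρc.mul (hψ.comp (continuous_const.sub continuous_id))).integrable_of_hasCompactSupport
    hρs.mul_right

/-- `A_ρ ψ` is continuous. [cite: Brezis2011, Prop. 4.19] -/
theorem continuous_mollify (hρc : Continuous ρ) (hρs : HasCompactSupport ρ) (hψ : Continuous ψ) :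
    Continuous (mollify ρ ψ) := by
  haveI := volume_isNegInvariant
  rw [mollify_eq_convolution]
  exact hρs.continuous_convolution_left (L := ContinuousLinearMap.lsmul ℝ ℝ) hρc
    (hψ.locallyIntegrable (μ := volume))

/-- `A_ρ ψ` has compact support. [cite: Brezis2011, Prop. 4.18] -/
theorem hasCompactSupport_mollify (hρs : HasCompactSupport ρ) (hψs : HasCompactSupport ψ) :
    HasCompactSupport (mollify ρ ψ) := by
  rw [mollify_eq_convolution]
  exact hρs.convolution (L := ContinuousLinearMap.lsmul ℝ ℝ) (μ := volume) hψs

/-- `A_ρ` is additive on continuous functions. [cite: Brezis2011, §4.4] -/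
theorem mollify_add (hρc : Continuous ρ) (hρs : HasCompactSupport ρ) {ψ ψ' : ZM → ℝ}
    (hψ : Continuous ψ) (hψ' : Continuous ψ') :
    mollify ρ (ψ + ψ') = mollify ρ ψ + mollify ρ ψ' := by
  funext x
  simp only [mollify, Pi.add_apply, mul_add]
  exact integral_add (integrable_mollifyIntegrand hρc hρs hψ x) (integrable_mollifyIntegrand hρc hρs hψ' x)

/-- `A_ρ` is homogeneous. [cite: Brezis2011, §4.4] -/
theorem mollify_smul (ρ : ZM → ℝ) (c : ℝ) (ψ : ZM → ℝ) : mollify ρ (c • ψ) = c • mollify ρ ψ := by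
  funext x
  simp only [mollify, Pi.smul_apply, smul_eq_mul]
  rw [← integral_const_mul]
  exact integral_congr_ae (Eventually.of_forall fun t => by ring)

/-- `(A_ρ ψ)²` has compact support. [cite: Brezis2011, Prop. 4.18] -/
theorem hasCompactSupport_mollify_sq (hρs : HasCompactSupport ρ) (hψs : HasCompactSupport ψ) :
    HasCompactSupport fun x => mollify ρ ψ x ^ 2 :=
  (hasCompactSupport_mollify hρs hψs).comp_left (g := fun r : ℝ => r ^ 2) (by simp)

/-- `(A_ρ ψ)²` is integrable. [cite: Brezis2011, §4.4] -/
theorem integrable_mollify_sq (hρc : Continuous ρ) (hρs : HasCompactSupport ρ) (hψ : Continuous ψ)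
    (hψs : HasCompactSupport ψ) : Integrable fun x => mollify ρ ψ x ^ 2 :=
  ((continuous_mollify hρc hρs hψ).pow 2).integrable_of_hasCompactSupport
    (hasCompactSupport_mollify_sq hρs hψs)

/-- `‖x‖ (A_ρ ψ)²` is integrable. [cite: Brezis2011, §4.4] -/
theorem integrable_norm_mul_mollify_sq (hρc : Continuous ρ) (hρs : HasCompactSupport ρ)
    (hψ : Continuous ψ) (hψs : HasCompactSupport ψ) :
    Integrable fun x => ‖x‖ * mollify ρ ψ x ^ 2 := by
  have h := hasCompactSupport_mollify_sq hρs hψs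
  exact (continuous_norm.mul ((continuous_mollify hρc hρs hψ).pow 2)).integrable_of_hasCompactSupport
    h.mul_left

/-- `(A_ρ ψ − ψ)²` is integrable. [cite: Brezis2011, §4.4] -/
theorem integrable_sq_mollify_sub (hρc : Continuous ρ) (hρs : HasCompactSupport ρ)
    (hψ : Continuous ψ) (hψs : HasCompactSupport ψ) :
    Integrable fun x => (mollify ρ ψ x - ψ x) ^ 2 := by
  have h1 : HasCompactSupport fun x => mollify ρ ψ x - ψ x := (hasCompactSupport_mollify hρs hψs).sub hψs
  have h2 : HasCompactSupport fun x => (mollify ρ ψ x - ψ x) ^ 2 :=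
    h1.comp_left (g := fun r : ℝ => r ^ 2) (by simp)
  exact (((continuous_mollify hρc hρs hψ).sub hψ).pow 2).integrable_of_hasCompactSupport h2

/-- **Jensen / Cauchy–Schwarz for a probability density**: `(∫ ρ f)² ≤ ∫ ρ f²` (`ρ ≥ 0`, `∫ρ = 1`).
[cite: Brezis2011, Thm. 4.6 (Hölder)] -/
theorem sq_integral_mul_le_integral_mul_sq (hρ0 : ∀ t, 0 ≤ ρ t) (hρ1 : ∫ t, ρ t = 1)
    (hρi : Integrable ρ) {f : ZM → ℝ} (h1 : Integrable fun t => ρ t * f t)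
    (h2 : Integrable fun t => ρ t * f t ^ 2) :
    (∫ t, ρ t * f t) ^ 2 ≤ ∫ t, ρ t * f t ^ 2 := by
  set m := ∫ t, ρ t * f t with hm
  have h0 : 0 ≤ ∫ t, ρ t * (f t - m) ^ 2 := integral_nonneg fun t => mul_nonneg (hρ0 t) (sq_nonneg _)
  have hexp : ∫ t, ρ t * (f t - m) ^ 2 =
      (∫ t, ρ t * f t ^ 2) - 2 * m * (∫ t, ρ t * f t) + m ^ 2 * ∫ t, ρ t := by
    have hfun : (fun t => ρ t * (f t - m) ^ 2) =
        fun t => (ρ t * f t ^ 2 - 2 * m * (ρ t * f t)) + m ^ 2 * ρ t := by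
      funext t; ring
    have I1 : Integrable (fun t => ρ t * f t ^ 2 - 2 * m * (ρ t * f t)) := h2.sub (h1.const_mul _)
    have I2 : Integrable (fun t => m ^ 2 * ρ t) := hρi.const_mul _
    have I3 : Integrable (fun t => 2 * m * (ρ t * f t)) := h1.const_mul _
    rw [hfun, integral_add I1 I2, integral_sub h2 I3, integral_const_mul, integral_const_mul]
  rw [hexp, hρ1, ← hm] at h0
  nlinarith

/-- **Pointwise bound**: `(A_ρ ψ)(x)² ≤ (sup ρ) ‖ψ‖²_{L²}`. [cite: Brezis2011, Thm. 4.26 (proof, Step 2)] -/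
theorem mollify_sq_le (hρc : Continuous ρ) (hρs : HasCompactSupport ρ) (hρ0 : ∀ t, 0 ≤ ρ t)
    (hρ1 : ∫ t, ρ t = 1) {ρmax : ℝ} (hρmax : ∀ t, ρ t ≤ ρmax)
    (hψ : Continuous ψ) (hψs : HasCompactSupport ψ) (x : ZM) :
    mollify ρ ψ x ^ 2 ≤ ρmax * ∫ y, ψ y ^ 2 := by
  haveI := volume_isNegInvariant
  have hψx : Continuous fun t => ψ (x - t) := hψ.comp (continuous_const.sub continuous_id)
  have hψxs : HasCompactSupport fun t => ψ (x - t) := hψs.comp_homeomorph (Homeomorph.subLeft x)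
  have hψxs2 : HasCompactSupport fun t => ψ (x - t) ^ 2 :=
    hψxs.comp_left (g := fun r : ℝ => r ^ 2) (by simp)
  have hρi : Integrable ρ := hρc.integrable_of_hasCompactSupport hρs
  have h1 : Integrable fun t => ρ t * ψ (x - t) := integrable_mollifyIntegrand hρc hρs hψ x
  have h2 : Integrable fun t => ρ t * ψ (x - t) ^ 2 :=
    (hρc.mul (hψx.pow 2)).integrable_of_hasCompactSupport hρs.mul_right
  have h4 : Integrable fun t => ψ (x - t) ^ 2 := (hψx.pow 2).integrable_of_hasCompactSupport hψxs2
  have hJ := sq_integral_mul_le_integral_mul_sq hρ0 hρ1 hρi h1 h2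
  have h3 : ∫ t, ρ t * ψ (x - t) ^ 2 ≤ ∫ t, ρmax * ψ (x - t) ^ 2 :=
    integral_mono h2 (h4.const_mul ρmax) fun t => mul_le_mul_of_nonneg_right (hρmax t) (sq_nonneg _)
  rw [integral_const_mul, integral_sub_left_eq_self (fun t => ψ t ^ 2) volume x] at h3
  exact hJ.trans h3

/-- `A_ρ ψ − ψ` as one integral (uses `∫ρ = 1`). [cite: Brezis2011, Thm. 4.26 (proof, Step 1)] -/
theorem mollify_sub_eq (hρc : Continuous ρ) (hρs : HasCompactSupport ρ) (hρ1 : ∫ t, ρ t = 1)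
    (hψ : Continuous ψ) (x : ZM) :
    mollify ρ ψ x - ψ x = ∫ t, ρ t * (ψ (x - t) - ψ x) := by
  have hρi : Integrable ρ := hρc.integrable_of_hasCompactSupport hρs
  simp only [mollify, mul_sub]
  rw [integral_sub (integrable_mollifyIntegrand hρc hρs hψ x) (hρi.mul_const _), integral_mul_const, hρ1,
    one_mul]

/-! #### The translation estimate `‖ψ(· − t) − ψ‖₂ ≤ ‖t‖ ‖∇ψ‖₂` -/

/-- **Fundamental theorem along a segment**: `ψ(x − t) − ψ(x) = ∫₀¹ −Dψ(x − s t)·t ds` for `C¹` `ψ`.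
[cite: Brezis2011, Prop. 9.3 (proof)] -/
theorem sub_eq_intervalIntegral_fderiv (hψ : ContDiff ℝ 1 ψ) (x t : ZM) :
    ψ (x - t) - ψ x = ∫ s in (0 : ℝ)..1, -(fderiv ℝ ψ (x - s • t) t) := by
  have hd : Differentiable ℝ ψ := hψ.differentiable one_ne_zero
  have hderiv : ∀ s : ℝ, HasDerivAt (fun s : ℝ => ψ (x - s • t)) (-(fderiv ℝ ψ (x - s • t) t)) s := by
    intro s
    have h1 : HasDerivAt (fun s : ℝ => x - s • t) (-t) s := by
      have := ((hasDerivAt_id s).smul_const t).const_sub x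
      simpa using this
    have h2 : HasDerivAt (fun s : ℝ => ψ (x - s • t)) ((fderiv ℝ ψ (x - s • t)) (-t)) s :=
      (hd (x - s • t)).hasFDerivAt.comp_hasDerivAt s h1
    simpa only [map_neg] using h2
  have hcont : Continuous fun s : ℝ => -(fderiv ℝ ψ (x - s • t) t) :=
    (((hψ.continuous_fderiv one_ne_zero).comp (continuous_const.sub (continuous_id.smul continuous_const))).clm_apply
      continuous_const).neg
  rw [intervalIntegral.integral_eq_sub_of_hasDerivAt (fun s _ => hderiv s) (hcont.intervalIntegrable 0 1)]
  simp

/-- `(Dψ(y) t)² ≤ ‖∇ψ(y)‖² ‖t‖²`. [cite: Brezis2011, Prop. 9.3 (proof)] -/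
theorem sq_fderiv_le (ψ : ZM → ℝ) (y t : ZM) :
    (fderiv ℝ ψ y t) ^ 2 ≤ ‖gradient ψ y‖ ^ 2 * ‖t‖ ^ 2 := by
  rw [← inner_gradient_left, ← mul_pow]
  have h := abs_real_inner_le_norm (gradient ψ y) t
  have h0 : 0 ≤ ‖gradient ψ y‖ * ‖t‖ := by positivity
  calc ⟪gradient ψ y, t⟫ ^ 2 = |⟪gradient ψ y, t⟫| ^ 2 := (sq_abs _).symm
    _ ≤ (‖gradient ψ y‖ * ‖t‖) ^ 2 := pow_le_pow_left₀ (abs_nonneg _) h 2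

/-- Pointwise: `(ψ(x − t) − ψ(x))² ≤ ∫₀¹ ‖t‖² ‖∇ψ(x − s t)‖² ds`. [cite: Brezis2011, Prop. 9.3 (proof)] -/
theorem sq_sub_le_intervalIntegral (hψ : ContDiff ℝ 1 ψ) (x t : ZM) :
    (ψ (x - t) - ψ x) ^ 2 ≤ ∫ s in (0 : ℝ)..1, ‖t‖ ^ 2 * ‖gradient ψ (x - s • t)‖ ^ 2 := by
  have hcont : Continuous fun s : ℝ => -(fderiv ℝ ψ (x - s • t) t) :=
    (((hψ.continuous_fderiv one_ne_zero).comp (continuous_const.sub (continuous_id.smul continuous_const))).clm_apply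
      continuous_const).neg
  have hcont2 : Continuous fun s : ℝ => ‖t‖ ^ 2 * ‖gradient ψ (x - s • t)‖ ^ 2 := by
    have hg : Continuous fun y => gradient ψ y :=
      (InnerProductSpace.toDual ℝ ZM).symm.continuous.comp (hψ.continuous_fderiv one_ne_zero)
    exact continuous_const.mul ((hg.comp (continuous_const.sub (continuous_id.smul continuous_const))).norm.pow 2)
  rw [sub_eq_intervalIntegral_fderiv hψ x t]
  refine (Literature.Analysis.PDE.sq_integral_unit_interval_le hcont).trans ?_
  refine intervalIntegral.integral_mono_on zero_le_one ((hcont.pow 2).intervalIntegrable 0 1)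
    (hcont2.intervalIntegrable 0 1) fun s _ => ?_
  rw [neg_sq, mul_comm]
  exact sq_fderiv_le ψ (x - s • t) t


/-- A compactly supported function on `ℝ⁹` vanishes outside some ball. [folklore] -/
private theorem exists_radius_of_hasCompactSupport {F : Type*} [Zero F] [TopologicalSpace F]
    {f : ZM → F} (hf : HasCompactSupport f) : ∃ R, 0 < R ∧ ∀ y, R < ‖y‖ → f y = 0 := by
  obtain ⟨r, hr⟩ := hf.isCompact.isBounded.subset_closedBall 0
  refine ⟨max r 1, lt_max_of_lt_right one_pos, fun y hy => image_eq_zero_of_notMem_tsupport fun h => ?_⟩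
  have h1 := hr h
  rw [Metric.mem_closedBall, dist_zero_right] at h1
  linarith [le_max_left r 1]

/-- Clamp to `[0,1]`. [folklore] -/
private def clamp01 (s : ℝ) : ℝ := max 0 (min s 1)

/-- `clamp01` is continuous. [folklore] -/
private theorem continuous_clamp01 : Continuous clamp01 :=
  continuous_const.max (continuous_id.min continuous_const)

/-- `clamp01 s ∈ [0,1]`. [folklore] -/
private theorem clamp01_mem (s : ℝ) : clamp01 s ∈ Set.Icc (0 : ℝ) 1 :=
  ⟨le_max_left _ _, max_le zero_le_one (min_le_right _ _)⟩

/-- `clamp01 = id` on `(0,1]`. [folklore] -/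
private theorem clamp01_eq {s : ℝ} (hs : s ∈ Set.Ioc (0 : ℝ) 1) : clamp01 s = s := by
  unfold clamp01
  rw [min_eq_left hs.2, max_eq_right hs.1.le]

/-- `Ioc 0 1` has Lebesgue measure one, so the restricted measure is finite. [folklore] -/
private theorem isFiniteMeasure_restrict_Ioc :
    IsFiniteMeasure ((volume : Measure ℝ).restrict (Set.Ioc (0 : ℝ) 1)) :=
  ⟨by rw [Measure.restrict_apply_univ, Real.volume_Ioc]; exact ENNReal.ofReal_lt_top⟩

/-- **Fubini for a continuous kernel localised in the first variable**: if `G : ℝ⁹ × ℝ → ℝ` is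
continuous, bounded, and vanishes for `‖x‖ > R`, the `x`- and `s ∈ (0,1]`-integrals commute, and the
inner `s`-integral is an integrable function of `x`. [folklore] -/
private theorem swap_Ioc {G : ZM → ℝ → ℝ} (hG : Continuous (Function.uncurry G)) {R C : ℝ}
    (hR : ∀ x s, R < ‖x‖ → G x s = 0) (hC : ∀ x s, |G x s| ≤ C) :
    Integrable (Function.uncurry G) ((volume : Measure ZM).prod (volume.restrict (Set.Ioc (0 : ℝ) 1))) ∧
    ∫ x, ∫ s in Set.Ioc (0 : ℝ) 1, G x s = ∫ s in Set.Ioc (0 : ℝ) 1, ∫ x, G x s := by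
  haveI := isFiniteMeasure_restrict_Ioc
  set B : Set ZM := Metric.closedBall (0 : ZM) R
  have hBm : MeasurableSet B := Metric.isClosed_closedBall.measurableSet
  have hC0 : 0 ≤ C := (abs_nonneg _).trans (hC 0 0)
  have hf : Integrable (B.indicator fun _ => C) (volume : Measure ZM) :=
    (integrable_indicator_iff hBm).2 (integrableOn_const measure_closedBall_lt_top.ne)
  have hbound : Integrable (fun z : ZM × ℝ => (B.indicator fun _ => C) z.1 * (1 : ℝ))
      ((volume : Measure ZM).prod (volume.restrict (Set.Ioc (0 : ℝ) 1))) :=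
    hf.mul_prod (integrable_const (1 : ℝ))
  have hint : Integrable (Function.uncurry G)
      ((volume : Measure ZM).prod (volume.restrict (Set.Ioc (0 : ℝ) 1))) := by
    refine hbound.mono' hG.aestronglyMeasurable (Eventually.of_forall fun z => ?_)
    rw [Function.uncurry_apply_pair, Real.norm_eq_abs, mul_one]
    by_cases hz : z.1 ∈ B
    · rw [Set.indicator_of_mem hz]
      exact hC _ _
    · rw [Set.indicator_of_notMem hz]
      have hz' : R < ‖z.1‖ := by
        rw [Metric.mem_closedBall, dist_zero_right, not_le] at hz
        exact hz
      rw [hR _ _ hz', abs_zero]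
  exact ⟨hint, integral_integral_swap hint⟩

/-- **Translation estimate**: `∫ (ψ(x − t) − ψ(x))² dx ≤ ‖t‖² ∫ ‖∇ψ‖²` for a `C¹` function with
compact support. [cite: Brezis2011, Prop. 9.3] -/
theorem integral_sq_sub_translate_le (hψ : ContDiff ℝ 1 ψ) (hψs : HasCompactSupport ψ) (t : ZM) :
    ∫ x, (ψ (x - t) - ψ x) ^ 2 ≤ ‖t‖ ^ 2 * ∫ x, ‖gradient ψ x‖ ^ 2 := by
  -- continuity / support / bounds for the gradient
  have hgc : Continuous fun y => gradient ψ y :=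
    (InnerProductSpace.toDual ℝ ZM).symm.continuous.comp (hψ.continuous_fderiv one_ne_zero)
  have hgs : HasCompactSupport fun y => gradient ψ y := by
    have h := hψs.fderiv (𝕜 := ℝ)
    refine h.mono ?_  -- support (gradient) ⊆ support (fderiv)
    intro y hy
    rw [Function.mem_support] at hy ⊢
    intro h0
    apply hy
    change (InnerProductSpace.toDual ℝ ZM).symm (fderiv ℝ ψ y) = 0
    rw [h0, map_zero]
  obtain ⟨R, hR0, hR⟩ := exists_radius_of_hasCompactSupport hgs
  obtain ⟨C, hC⟩ := hgc.bounded_above_of_compact_support hgs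
  -- the kernel `G x s = ‖t‖² ‖∇ψ(x − clamp(s) t)‖²`
  set G : ZM → ℝ → ℝ := fun x s => ‖t‖ ^ 2 * ‖gradient ψ (x - clamp01 s • t)‖ ^ 2 with hGdef
  have hGc : Continuous (Function.uncurry G) := by
    have h1 : Continuous fun z : ZM × ℝ => z.1 - clamp01 z.2 • t :=
      continuous_fst.sub ((continuous_clamp01.comp continuous_snd).smul continuous_const)
    exact continuous_const.mul ((hgc.comp h1).norm.pow 2)
  have hGR : ∀ x s, R + ‖t‖ < ‖x‖ → G x s = 0 := by
    intro x s hx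
    have hc := clamp01_mem s
    have h1 : R < ‖x - clamp01 s • t‖ := by
      have h2 : ‖clamp01 s • t‖ ≤ ‖t‖ := by
        rw [norm_smul, Real.norm_eq_abs, abs_of_nonneg hc.1]
        exact mul_le_of_le_one_left (norm_nonneg _) hc.2
      have h3 := norm_sub_norm_le x (clamp01 s • t)
      have h4 : ‖x‖ - ‖clamp01 s • t‖ ≤ ‖x - clamp01 s • t‖ := by
        have := norm_le_norm_add_norm_sub' x (clamp01 s • t)  -- ‖x‖ ≤ ‖?‖ ...
        linarith [norm_sub_le_norm_sub_add_norm_sub x (clamp01 s • t) 0]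
      linarith
    simp only [hGdef, hR _ h1, norm_zero]
    ring
  have hGC : ∀ x s, |G x s| ≤ ‖t‖ ^ 2 * C ^ 2 := by
    intro x s
    rw [hGdef, abs_of_nonneg (by positivity)]
    exact mul_le_mul_of_nonneg_left (pow_le_pow_left₀ (norm_nonneg _) (hC _) 2) (sq_nonneg _)
  obtain ⟨hGi, hswap⟩ := swap_Ioc hGc hGR hGC
  -- pointwise bound, as a set integral of `G x ·` over `Ioc 0 1`
  have hpt : ∀ x, (ψ (x - t) - ψ x) ^ 2 ≤ ∫ s in Set.Ioc (0 : ℝ) 1, G x s := by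
    intro x
    refine (sq_sub_le_intervalIntegral hψ x t).trans (le_of_eq ?_)
    rw [intervalIntegral.integral_of_le zero_le_one]
    refine setIntegral_congr_fun measurableSet_Ioc fun s hs => ?_
    simp only [hGdef, clamp01_eq hs]
  -- integrate
  have hlhs : Integrable fun x => (ψ (x - t) - ψ x) ^ 2 := by
    have hc : Continuous fun x => (ψ (x - t) - ψ x) ^ 2 :=
      ((hψ.continuous.comp (continuous_id.sub continuous_const)).sub hψ.continuous).pow 2
    refine hc.integrable_of_hasCompactSupport ?_
    have h1 : HasCompactSupport fun x => ψ (x - t) := hψs.comp_homeomorph (Homeomorph.subRight t)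
    exact (h1.sub hψs).comp_left (g := fun r : ℝ => r ^ 2) (by simp)
  calc ∫ x, (ψ (x - t) - ψ x) ^ 2 ≤ ∫ x, ∫ s in Set.Ioc (0 : ℝ) 1, G x s :=
        integral_mono hlhs hGi.integral_prod_left hpt
    _ = ∫ s in Set.Ioc (0 : ℝ) 1, ∫ x, G x s := hswap
    _ = ∫ s in Set.Ioc (0 : ℝ) 1, ‖t‖ ^ 2 * ∫ x, ‖gradient ψ x‖ ^ 2 := by
        refine setIntegral_congr_fun measurableSet_Ioc fun s _ => ?_
        simp only [hGdef]
        rw [integral_const_mul, integral_sub_right_eq_self (fun x => ‖gradient ψ x‖ ^ 2) (clamp01 s • t)]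
    _ = ‖t‖ ^ 2 * ∫ x, ‖gradient ψ x‖ ^ 2 := by
        rw [setIntegral_const, measureReal_def, Real.volume_Ioc, sub_zero, ENNReal.toReal_ofReal zero_le_one,
          one_smul]


/-- **Fubini on `ℝ⁹ × ℝ⁹` for a continuous kernel localised in both variables.** [folklore] -/
private theorem swap_ZM {H : ZM → ZM → ℝ} (hH : Continuous (Function.uncurry H)) {R₁ R₂ : ℝ}
    (h1 : ∀ x t, R₁ < ‖x‖ → H x t = 0) (h2 : ∀ x t, R₂ < ‖t‖ → H x t = 0) :
    Integrable (Function.uncurry H) ((volume : Measure ZM).prod volume) ∧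
    ∫ x, ∫ t, H x t = ∫ t, ∫ x, H x t := by
  have hK : IsCompact (Metric.closedBall (0 : ZM) R₁ ×ˢ Metric.closedBall (0 : ZM) R₂) :=
    (isCompact_closedBall _ _).prod (isCompact_closedBall _ _)
  have hsupp : HasCompactSupport (Function.uncurry H) := by
    refine HasCompactSupport.intro hK fun z hz => ?_
    rw [Set.mem_prod, not_and_or, Metric.mem_closedBall, Metric.mem_closedBall, dist_zero_right,
      dist_zero_right, not_le, not_le] at hz
    rcases hz with hz | hz
    · exact h1 _ _ hz
    · exact h2 _ _ hz
  have hint : Integrable (Function.uncurry H) ((volume : Measure ZM).prod volume) := by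
    have := hH.integrable_of_hasCompactSupport hsupp (μ := (volume : Measure (ZM × ZM)))
    simpa [Measure.volume_eq_prod] using this
  exact ⟨hint, integral_integral_swap hint⟩

/-- `‖x‖ - ‖t‖ ≤ ‖x - t‖`. [folklore] -/
private theorem norm_sub_norm_le' (x t : ZM) : ‖x‖ - ‖t‖ ≤ ‖x - t‖ := by
  have := norm_le_norm_add_norm_sub' x t
  have h2 : ‖x‖ ≤ ‖x - t‖ + ‖t‖ := by
    calc ‖x‖ = ‖(x - t) + t‖ := by rw [sub_add_cancel]
      _ ≤ ‖x - t‖ + ‖t‖ := norm_add_le _ _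
  linarith

/-- **Mollification error in `L²`**: `∫ (A_ρ ψ − ψ)² ≤ δ² ∫ ‖∇ψ‖²` when `ρ` is a probability density
supported in `‖t‖ ≤ δ`. [cite: Brezis2011, Thm. 4.26 (proof, Step 1, eq. (23)) & Prop. 9.3] -/
theorem integral_sq_mollify_sub_le (hρc : Continuous ρ) (hρs : HasCompactSupport ρ) (hρ0 : ∀ t, 0 ≤ ρ t)
    (hρ1 : ∫ t, ρ t = 1) {δ : ℝ} (hδ : 0 ≤ δ) (hρδ : ∀ t, δ < ‖t‖ → ρ t = 0)
    (hψ : ContDiff ℝ 1 ψ) (hψs : HasCompactSupport ψ) :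
    ∫ x, (mollify ρ ψ x - ψ x) ^ 2 ≤ δ ^ 2 * ∫ x, ‖gradient ψ x‖ ^ 2 := by
  have hρi : Integrable ρ := hρc.integrable_of_hasCompactSupport hρs
  obtain ⟨Rψ, _, hRψ⟩ := exists_radius_of_hasCompactSupport hψs
  set H : ZM → ZM → ℝ := fun x t => ρ t * (ψ (x - t) - ψ x) ^ 2 with hHdef
  have hHc : Continuous (Function.uncurry H) :=
    (hρc.comp continuous_snd).mul (((hψ.continuous.comp (continuous_fst.sub continuous_snd)).sub
      (hψ.continuous.comp continuous_fst)).pow 2)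
  have hH2 : ∀ x t, δ < ‖t‖ → H x t = 0 := fun x t ht => by
    simp only [hHdef, hρδ t ht, zero_mul]
  have hH1 : ∀ x t, Rψ + δ < ‖x‖ → H x t = 0 := by
    intro x t hx
    by_cases ht : δ < ‖t‖
    · exact hH2 x t ht
    · rw [not_lt] at ht
      have hxt : Rψ < ‖x - t‖ := by linarith [norm_sub_norm_le' x t]
      have hx' : Rψ < ‖x‖ := by linarith [norm_nonneg t]
      simp only [hHdef, hRψ _ hxt, hRψ _ hx', sub_zero]
      ring
  obtain ⟨hHi, hswap⟩ := swap_ZM hHc hH1 hH2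
  -- pointwise Jensen
  have hpt : ∀ x, (mollify ρ ψ x - ψ x) ^ 2 ≤ ∫ t, H x t := by
    intro x
    rw [mollify_sub_eq hρc hρs hρ1 hψ.continuous x]
    have hc : Continuous fun t => ψ (x - t) - ψ x :=
      (hψ.continuous.comp (continuous_const.sub continuous_id)).sub continuous_const
    exact sq_integral_mul_le_integral_mul_sq hρ0 hρ1 hρi
      ((hρc.mul hc).integrable_of_hasCompactSupport hρs.mul_right)
      ((hρc.mul (hc.pow 2)).integrable_of_hasCompactSupport hρs.mul_right)
  have hlhs : Integrable fun x => (mollify ρ ψ x - ψ x) ^ 2 := by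
    have hc : Continuous fun x => (mollify ρ ψ x - ψ x) ^ 2 :=
      ((continuous_mollify hρc hρs hψ.continuous).sub hψ.continuous).pow 2
    exact hc.integrable_of_hasCompactSupport
      (((hasCompactSupport_mollify hρs hψs).sub hψs).comp_left (g := fun r : ℝ => r ^ 2) (by simp))
  have hI1 : Integrable fun t => ρ t * ∫ x, (ψ (x - t) - ψ x) ^ 2 := by
    refine (hHi.integral_prod_right).congr (Eventually.of_forall fun t => ?_)
    simp only [Function.uncurry_apply_pair, hHdef]
    exact integral_const_mul _ _
  have hI2 : Integrable fun t => ρ t * (δ ^ 2 * ∫ x, ‖gradient ψ x‖ ^ 2) := hρi.mul_const _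
  calc ∫ x, (mollify ρ ψ x - ψ x) ^ 2 ≤ ∫ x, ∫ t, H x t := integral_mono hlhs hHi.integral_prod_left hpt
    _ = ∫ t, ∫ x, H x t := hswap
    _ = ∫ t, ρ t * ∫ x, (ψ (x - t) - ψ x) ^ 2 := by
        refine integral_congr_ae (Eventually.of_forall fun t => ?_)
        simp only [hHdef]
        exact integral_const_mul _ _
    _ ≤ ∫ t, ρ t * (δ ^ 2 * ∫ x, ‖gradient ψ x‖ ^ 2) := by
        refine integral_mono hI1 hI2 fun t => ?_
        by_cases ht : δ < ‖t‖
        · simp only [hρδ t ht, zero_mul, le_refl]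
        · rw [not_lt] at ht
          refine mul_le_mul_of_nonneg_left ?_ (hρ0 t)
          refine (integral_sq_sub_translate_le hψ hψs t).trans ?_
          exact mul_le_mul_of_nonneg_right (pow_le_pow_left₀ (norm_nonneg _) ht 2)
            (integral_nonneg fun x => sq_nonneg _)
    _ = δ ^ 2 * ∫ x, ‖gradient ψ x‖ ^ 2 := by
        rw [integral_mul_const, hρ1, one_mul]

/-- **Weight bound for the mollification**: `∫ ‖x‖ (A_ρ ψ)² ≤ ∫ ‖x‖ ψ² + δ ∫ ψ²` (the valley weight
is `1`-Lipschitz, the kernel has radius `δ`). [cite: SimonB1983DiscreteSpectrum, Cor. 4] -/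
theorem integral_norm_mul_mollify_sq_le (hρc : Continuous ρ) (hρs : HasCompactSupport ρ)
    (hρ0 : ∀ t, 0 ≤ ρ t) (hρ1 : ∫ t, ρ t = 1) {δ : ℝ} (hρδ : ∀ t, δ < ‖t‖ → ρ t = 0)
    (hψ : Continuous ψ) (hψs : HasCompactSupport ψ) :
    ∫ x, ‖x‖ * mollify ρ ψ x ^ 2 ≤ (∫ x, ‖x‖ * ψ x ^ 2) + δ * ∫ x, ψ x ^ 2 := by
  have hρi : Integrable ρ := hρc.integrable_of_hasCompactSupport hρs
  obtain ⟨Rψ, _, hRψ⟩ := exists_radius_of_hasCompactSupport hψs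
  set H : ZM → ZM → ℝ := fun x t => ρ t * (‖x‖ * ψ (x - t) ^ 2) with hHdef
  have hHc : Continuous (Function.uncurry H) :=
    (hρc.comp continuous_snd).mul (continuous_fst.norm.mul
      ((hψ.comp (continuous_fst.sub continuous_snd)).pow 2))
  have hH2 : ∀ x t, δ < ‖t‖ → H x t = 0 := fun x t ht => by
    simp only [hHdef, hρδ t ht, zero_mul]
  have hH1 : ∀ x t, Rψ + δ < ‖x‖ → H x t = 0 := by
    intro x t hx
    by_cases ht : δ < ‖t‖
    · exact hH2 x t ht
    · rw [not_lt] at ht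
      have hxt : Rψ < ‖x - t‖ := by linarith [norm_sub_norm_le' x t]
      simp only [hHdef, hRψ _ hxt]
      ring
  obtain ⟨hHi, hswap⟩ := swap_ZM hHc hH1 hH2
  -- integrability in `x`
  have hψ2s : HasCompactSupport fun x => ψ x ^ 2 := hψs.comp_left (g := fun r : ℝ => r ^ 2) (by simp)
  have hIψ2 : Integrable fun x => ψ x ^ 2 := (hψ.pow 2).integrable_of_hasCompactSupport hψ2s
  have hIwψ : Integrable fun x => ‖x‖ * ψ x ^ 2 :=
    (continuous_norm.mul (hψ.pow 2)).integrable_of_hasCompactSupport hψ2s.mul_left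
  have hm2s : HasCompactSupport fun x => mollify ρ ψ x ^ 2 :=
    (hasCompactSupport_mollify hρs hψs).comp_left (g := fun r : ℝ => r ^ 2) (by simp)
  have hlhs : Integrable fun x => ‖x‖ * mollify ρ ψ x ^ 2 :=
    (continuous_norm.mul ((continuous_mollify hρc hρs hψ).pow 2)).integrable_of_hasCompactSupport
      hm2s.mul_left
  -- pointwise Jensen (times `‖x‖ ≥ 0`)
  have hpt : ∀ x, ‖x‖ * mollify ρ ψ x ^ 2 ≤ ∫ t, H x t := by
    intro x
    have hc : Continuous fun t => ψ (x - t) := hψ.comp (continuous_const.sub continuous_id)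
    have hJ := sq_integral_mul_le_integral_mul_sq hρ0 hρ1 hρi
      ((hρc.mul hc).integrable_of_hasCompactSupport hρs.mul_right)
      ((hρc.mul (hc.pow 2)).integrable_of_hasCompactSupport hρs.mul_right)
    have h1 : ∫ t, H x t = ‖x‖ * ∫ t, ρ t * ψ (x - t) ^ 2 := by
      rw [← integral_const_mul]
      refine integral_congr_ae (Eventually.of_forall fun t => ?_)
      simp only [hHdef]
      ring
    rw [h1]
    exact mul_le_mul_of_nonneg_left hJ (norm_nonneg _)
  have hI1 : Integrable fun t => ρ t * ∫ x, ‖x‖ * ψ (x - t) ^ 2 := by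
    refine (hHi.integral_prod_right).congr (Eventually.of_forall fun t => ?_)
    simp only [Function.uncurry_apply_pair, hHdef]
    exact integral_const_mul _ _
  have hI2 : Integrable fun t => ρ t * ((∫ x, ‖x‖ * ψ x ^ 2) + δ * ∫ x, ψ x ^ 2) := hρi.mul_const _
  calc ∫ x, ‖x‖ * mollify ρ ψ x ^ 2 ≤ ∫ x, ∫ t, H x t := integral_mono hlhs hHi.integral_prod_left hpt
    _ = ∫ t, ∫ x, H x t := hswap
    _ = ∫ t, ρ t * ∫ x, ‖x‖ * ψ (x - t) ^ 2 := by
        refine integral_congr_ae (Eventually.of_forall fun t => ?_)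
        simp only [hHdef]
        exact integral_const_mul _ _
    _ ≤ ∫ t, ρ t * ((∫ x, ‖x‖ * ψ x ^ 2) + δ * ∫ x, ψ x ^ 2) := by
        refine integral_mono hI1 hI2 fun t => ?_
        by_cases ht : δ < ‖t‖
        · simp only [hρδ t ht, zero_mul, le_refl]
        · rw [not_lt] at ht
          refine mul_le_mul_of_nonneg_left ?_ (hρ0 t)
          have hshift : ∫ x, ‖x‖ * ψ (x - t) ^ 2 = ∫ y, ‖y + t‖ * ψ y ^ 2 := by
            rw [← integral_sub_right_eq_self (fun y => ‖y + t‖ * ψ y ^ 2) t]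
            refine integral_congr_ae (Eventually.of_forall fun x => ?_)
            simp only [sub_add_cancel]
          rw [hshift, ← integral_const_mul, ← integral_add hIwψ (hIψ2.const_mul δ)]
          refine integral_mono ?_ (hIwψ.add (hIψ2.const_mul δ)) fun y => ?_
          · exact ((continuous_id.add continuous_const).norm.mul (hψ.pow 2)).integrable_of_hasCompactSupport
              hψ2s.mul_left
          · have hn : ‖y + t‖ ≤ ‖y‖ + δ := (norm_add_le y t).trans (by linarith)
            have := mul_le_mul_of_nonneg_right hn (sq_nonneg (ψ y))
            simpa only [add_mul] using this
    _ = (∫ x, ‖x‖ * ψ x ^ 2) + δ * ∫ x, ψ x ^ 2 := by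
        rw [integral_mul_const, hρ1, one_mul]

end Mollify

/-! ### C. Low-energy subspaces are finite-dimensional; `μ_k → ∞` -/

section Assembly

variable {ψ : ZM → ℝ}

/-- `‖∇ψ‖²` is integrable for a test function. [cite: ReedSimonIV1978, Thm. XIII.2] -/
theorem IsTestFn.integrable_norm_gradient_sq (hψ : IsTestFn ψ) :
    Integrable fun x => ‖gradient ψ x‖ ^ 2 := by
  have h : (fun x => ‖gradient ψ x‖ ^ 2) = fun x => ∑ p, (pderiv p ψ x) ^ 2 := by
    funext x; exact norm_gradient_sq ψ x
  rw [h]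
  exact integrable_finsetSum _ fun p _ => hψ.integrable_pderiv_sq p

/-- **Kinetic bound**: `∫ ‖∇ψ‖² ≤ 2 𝔮(ψ)` (`V ≥ 0`). [cite: SimonB1983DiscreteSpectrum, §2] -/
theorem integral_norm_gradient_sq_le (hψ : IsTestFn ψ) :
    ∫ x, ‖gradient ψ x‖ ^ 2 ≤ 2 * energyForm ψ := by
  have I1 : Integrable fun x => (1 / 2 : ℝ) * ‖gradient ψ x‖ ^ 2 :=
    hψ.integrable_norm_gradient_sq.const_mul _
  have I2 : Integrable fun x => (1 / 2 : ℝ) * ‖gradient ψ x‖ ^ 2 + luscherPotential x * ψ x ^ 2 :=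
    I1.add (hψ.integrable_mul_sq continuous_luscherPotential)
  have h : ∫ x, (1 / 2 : ℝ) * ‖gradient ψ x‖ ^ 2 ≤ energyForm ψ := by
    unfold energyForm
    exact integral_mono I1 I2 fun x =>
      le_add_of_nonneg_right (mul_nonneg (luscherPotential_nonneg x) (sq_nonneg _))
  rw [integral_const_mul] at h
  linarith

/-- `∫ b² ≤ 2∫ a² + 2∫ (a − b)²` — the square-root-free triangle inequality. [folklore] -/
private theorem l2sq_le_of_sub {a b : ZM → ℝ} (ha : Integrable fun x => a x ^ 2)
    (hb : Integrable fun x => b x ^ 2) (hab : Integrable fun x => (a x - b x) ^ 2) :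
    ∫ x, b x ^ 2 ≤ 2 * (∫ x, a x ^ 2) + 2 * ∫ x, (a x - b x) ^ 2 := by
  rw [← integral_const_mul, ← integral_const_mul, ← integral_add (ha.const_mul 2) (hab.const_mul 2)]
  exact integral_mono hb ((ha.const_mul 2).add (hab.const_mul 2)) fun x => by
    nlinarith [sq_nonneg (2 * a x - b x)]

/-- The mollifier scale `δ(E) = 1/(2(√(2E)+1))`, chosen so that `δ² · 2E ≤ 1/4`.
[cite: SimonB1983DiscreteSpectrum, Cor. 4] -/
def mollScale (E : ℝ) : ℝ := 1 / (2 * (Real.sqrt (2 * E) + 1))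

/-- `δ(E) > 0`. [cite: SimonB1983DiscreteSpectrum, Cor. 4] -/
theorem mollScale_pos (E : ℝ) : 0 < mollScale E := by
  unfold mollScale
  have := Real.sqrt_nonneg (2 * E)
  positivity

/-- `δ(E)² · 2E ≤ 1/4`. [cite: SimonB1983DiscreteSpectrum, Cor. 4] -/
theorem mollScale_sq_mul_le {E : ℝ} (hE : 0 ≤ E) : mollScale E ^ 2 * (2 * E) ≤ 1 / 4 := by
  unfold mollScale
  have hs := Real.sq_sqrt (by linarith : 0 ≤ 2 * E)
  have hs0 := Real.sqrt_nonneg (2 * E)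
  rw [div_pow, one_pow, mul_pow, div_mul_eq_mul_div, one_mul, div_le_div_iff₀ (by positivity) (by norm_num)]
  nlinarith

/-- The standard bump at scale `δ`: `rIn = δ/2`, `rOut = δ`. [cite: Brezis2011, §4.4 (mollifiers)] -/
def mollBump {δ : ℝ} (hδ : 0 < δ) : ContDiffBump (0 : ZM) := ⟨δ / 2, δ, half_pos hδ, half_lt_self hδ⟩

/-- **The explicit dimension bound** `N(E) = 8 ρ_max(E) · vol B(0, 2T(E))` with
`ρ_max = 1 / vol B(0, δ/2)`, `T = 6E + 4δ`, `δ = δ(E)`. [cite: SimonB1983DiscreteSpectrum, Cor. 4] -/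
def dimBound (E : ℝ) : ℝ :=
  2 * (4 * (1 / (volume : Measure ZM).real (Metric.closedBall (0 : ZM) (mollScale E / 2)))) *
    (volume (Metric.closedBall (0 : ZM) (2 * (6 * E + 4 * mollScale E)))).toReal

/-- `N(E) ≥ 0`. [cite: SimonB1983DiscreteSpectrum, Cor. 4] -/
theorem dimBound_nonneg (E : ℝ) : 0 ≤ dimBound E := by
  unfold dimBound
  have : 0 ≤ (volume : Measure ZM).real (Metric.closedBall (0 : ZM) (mollScale E / 2)) :=
    measureReal_nonneg
  positivity

/-- **Low-energy admissible subspaces are finite-dimensional, quantitatively**: if every `ψ` in a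
finite-dimensional space `W` of `C²_c` trial functions has Rayleigh quotient `𝔮(ψ)/‖ψ‖² ≤ E`, then
`dim W ≤ N(E)`.  Proof (a Rellich-type argument made quantitative): mollify at scale `δ(E)`
(injective on `W` by the kinetic bound and `‖ρ⋆ψ − ψ‖₂ ≤ δ‖∇ψ‖₂`), then apply the trace bound
`finrank_le_of_pointwise_of_weight` with the valley bound `∫‖x‖ψ² ≤ (3/2)E‖ψ‖²`
(`integral_norm_sq_le_of_energyForm_le`). [cite: SimonB1983DiscreteSpectrum, Cor. 4]
[cite: ReedSimonIV1978, Thm. XIII.64] -/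
theorem finrank_le_dimBound {E : ℝ} (hE : 0 ≤ E) (W : Submodule ℝ (ZM → ℝ)) [FiniteDimensional ℝ W]
    (hadm : ∀ ψ ∈ W, IsTestFn ψ) (hray : ∀ ψ ∈ W, energyForm ψ ≤ E * l2sq ψ) :
    (Module.finrank ℝ W : ℝ) ≤ dimBound E := by
  -- the mollifier
  set δ := mollScale E with hδdef
  have hδ : 0 < δ := mollScale_pos E
  let φb : ContDiffBump (0 : ZM) := mollBump hδ
  set ρ : ZM → ℝ := φb.normed volume with hρdef
  have hρc : Continuous ρ := φb.continuous_normed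
  have hρs : HasCompactSupport ρ := φb.hasCompactSupport_normed
  have hρ0 : ∀ t, 0 ≤ ρ t := fun t => φb.nonneg_normed t
  have hρ1 : ∫ t, ρ t = 1 := φb.integral_normed
  have hρδ : ∀ t, δ < ‖t‖ → ρ t = 0 := by
    intro t ht
    have : t ∉ Function.support ρ := by
      rw [hρdef, φb.support_normed_eq, Metric.mem_ball, dist_zero_right, not_lt]
      exact ht.le
    simpa [Function.mem_support] using this
  set ρmax : ℝ := 1 / (volume : Measure ZM).real (Metric.closedBall (0 : ZM) (δ / 2)) with hρmaxdef
  have hρmax : ∀ t, ρ t ≤ ρmax := fun t => φb.normed_le_div_measure_closedBall_rIn volume t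
  have hρmax0 : 0 ≤ ρmax := (hρ0 0).trans (hρmax 0)
  -- basic estimates for `ψ ∈ W`
  have hW : ∀ ψ ∈ W, l2sq ψ ≤ 4 * l2sq (mollify ρ ψ) ∧
      (∀ x, mollify ρ ψ x ^ 2 ≤ ρmax * l2sq ψ) ∧
      ∫ x, ‖x‖ * mollify ρ ψ x ^ 2 ≤ ((3 / 2 : ℝ) * E + δ) * l2sq ψ := by
    intro ψ hψW
    have hψ := hadm ψ hψW
    have h1 : ContDiff ℝ 1 ψ := hψ.1.of_le (by norm_num)
    have hmd := integral_sq_mollify_sub_le hρc hρs hρ0 hρ1 hδ.le hρδ h1 hψ.2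
    have hkin := integral_norm_gradient_sq_le hψ
    have hrayψ := hray ψ hψW
    have hl2 : 0 ≤ l2sq ψ := l2sq_nonneg ψ
    -- `∫ (Aψ − ψ)² ≤ l2sq ψ / 4`
    have herr : ∫ x, (mollify ρ ψ x - ψ x) ^ 2 ≤ l2sq ψ / 4 := by
      have h2 : δ ^ 2 * ∫ x, ‖gradient ψ x‖ ^ 2 ≤ δ ^ 2 * (2 * (E * l2sq ψ)) :=
        mul_le_mul_of_nonneg_left (hkin.trans (by linarith)) (sq_nonneg _)
      have h3 : δ ^ 2 * (2 * (E * l2sq ψ)) = (δ ^ 2 * (2 * E)) * l2sq ψ := by ring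
      have h4 := mollScale_sq_mul_le hE
      rw [← hδdef] at h4
      have h5 : (δ ^ 2 * (2 * E)) * l2sq ψ ≤ (1 / 4) * l2sq ψ := mul_le_mul_of_nonneg_right h4 hl2
      linarith
    have hIm2 : Integrable fun x => mollify ρ ψ x ^ 2 := integrable_mollify_sq hρc hρs hψ.continuous hψ.2
    have hIerr : Integrable fun x => (mollify ρ ψ x - ψ x) ^ 2 :=
      integrable_sq_mollify_sub hρc hρs hψ.continuous hψ.2
    refine ⟨?_, fun x => ?_, ?_⟩
    · have := l2sq_le_of_sub hIm2 hψ.integrable_sq hIerr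
      unfold l2sq at herr this ⊢
      linarith
    · have := mollify_sq_le hρc hρs hρ0 hρ1 hρmax hψ.continuous hψ.2 x
      unfold l2sq
      exact this
    · have hwb := integral_norm_mul_mollify_sq_le hρc hρs hρ0 hρ1 hρδ hψ.continuous hψ.2
      have hval := integral_norm_sq_le_of_energyForm_le hψ hrayψ
      unfold l2sq at hval ⊢
      nlinarith
  -- the mollification as a linear map on `W`, injective
  let L : W →ₗ[ℝ] (ZM → ℝ) :=
    { toFun := fun ψ => mollify ρ (ψ : ZM → ℝ)
      map_add' := fun ψ ψ' => mollify_add hρc hρs (hadm _ ψ.2).continuous (hadm _ ψ'.2).continuous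
      map_smul' := fun c ψ => mollify_smul ρ c ψ }
  have hLinj : Function.Injective L := by
    intro ψ ψ' h
    have hmem : ((ψ : ZM → ℝ) - ψ') ∈ W := W.sub_mem ψ.2 ψ'.2
    have hL0 : mollify ρ ((ψ : ZM → ℝ) - ψ') = 0 := by
      have := L.map_sub ψ ψ'
      rw [h, sub_self] at this
      simpa [L] using this
    have h4 := (hW _ hmem).1
    rw [hL0] at h4
    have h0 : l2sq (0 : ZM → ℝ) = 0 := by simp [l2sq]
    rw [h0, mul_zero] at h4
    by_contra hne
    have hne' : ((ψ : ZM → ℝ) - ψ') ≠ 0 := fun h' => hne (Subtype.ext (sub_eq_zero.1 h'))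
    exact absurd h4 (not_le.2 (l2sq_pos_of_ne_zero (hadm _ hmem) hne'))
  set V : Submodule ℝ (ZM → ℝ) := LinearMap.range L with hVdef
  have hVW : Module.finrank ℝ V = Module.finrank ℝ W := LinearMap.finrank_range_of_inj hLinj
  have hVmem : ∀ φ ∈ V, ∃ ψ ∈ W, φ = mollify ρ ψ := by
    intro φ hφ
    obtain ⟨ψ, rfl⟩ := LinearMap.mem_range.1 hφ
    exact ⟨ψ, ψ.2, rfl⟩
  -- hypotheses of the trace bound
  have hT : 0 < 4 * ((3 / 2 : ℝ) * E + δ) := by positivity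
  have key := finrank_le_of_pointwise_of_weight V
    (fun φ hφ => by
      obtain ⟨ψ, hψW, rfl⟩ := hVmem φ hφ
      exact (continuous_mollify hρc hρs (hadm ψ hψW).continuous).aestronglyMeasurable)
    (fun φ hφ => by
      obtain ⟨ψ, hψW, rfl⟩ := hVmem φ hφ
      exact integrable_mollify_sq hρc hρs (hadm ψ hψW).continuous (hadm ψ hψW).2)
    (fun φ hφ => by
      obtain ⟨ψ, hψW, rfl⟩ := hVmem φ hφ
      exact integrable_norm_mul_mollify_sq hρc hρs (hadm ψ hψW).continuous (hadm ψ hψW).2)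
    (fun φ hφ h0 => by
      obtain ⟨ψ, hψW, rfl⟩ := hVmem φ hφ
      have h4 := (hW ψ hψW).1
      have hl : l2sq (mollify ρ ψ) = 0 := h0
      rw [hl, mul_zero] at h4
      have hψ0 : ψ = 0 := by
        by_contra hne
        exact absurd h4 (not_le.2 (l2sq_pos_of_ne_zero (hadm ψ hψW) hne))
      rw [hψ0]
      funext x
      simp [mollify])
    (A := 4 * ρmax) (T := 4 * ((3 / 2 : ℝ) * E + δ)) (by positivity) hT
    (fun φ hφ x => by
      obtain ⟨ψ, hψW, rfl⟩ := hVmem φ hφ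
      have h1 := (hW ψ hψW).2.1 x
      have h4 := (hW ψ hψW).1
      have : ρmax * l2sq ψ ≤ ρmax * (4 * l2sq (mollify ρ ψ)) := mul_le_mul_of_nonneg_left h4 hρmax0
      have e : (∫ y, mollify ρ ψ y ^ 2) = l2sq (mollify ρ ψ) := rfl
      rw [e]
      linarith)
    (fun φ hφ => by
      obtain ⟨ψ, hψW, rfl⟩ := hVmem φ hφ
      have h1 := (hW ψ hψW).2.2
      have h4 := (hW ψ hψW).1
      have hc : 0 ≤ (3 / 2 : ℝ) * E + δ := by positivity
      have : ((3 / 2 : ℝ) * E + δ) * l2sq ψ ≤ ((3 / 2 : ℝ) * E + δ) * (4 * l2sq (mollify ρ ψ)) :=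
        mul_le_mul_of_nonneg_left h4 hc
      have e : (∫ y, mollify ρ ψ y ^ 2) = l2sq (mollify ρ ψ) := rfl
      rw [e]
      linarith)
  rw [hVW] at key
  refine key.trans (le_of_eq ?_)
  simp only [dimBound, ← hδdef, ← hρmaxdef]
  ring_nf

/-- **Energy below `E` forces dimension `≤ N(E)`; contrapositive in min–max form**: for `k > N(E)`,
`μ_k^inv ≥ E`. [cite: SimonB1983DiscreteSpectrum, Cor. 4] -/
theorem le_physLevel_of_dimBound_lt {E : ℝ} (hE : 0 ≤ E) {k : ℕ} (hk : dimBound E < k) :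
    E ≤ physLevel k := by
  rcases Nat.eq_zero_or_pos k with rfl | hpos
  · exact absurd hk (not_lt.2 (by simpa using dimBound_nonneg E))
  rw [physLevel_eq_sInf]
  refine le_csInf (levelSet_nonempty k) fun s hs => ?_
  by_contra hlt
  rw [not_le] at hlt
  obtain ⟨W, hWk, hadm, hray⟩ := hs
  obtain ⟨n, hn⟩ : ∃ n, k = n + 1 := ⟨k - 1, by omega⟩
  haveI : FiniteDimensional ℝ W := Module.finite_of_finrank_eq_succ (hWk.trans hn)
  have hray' : ∀ ψ ∈ W, energyForm ψ ≤ E * l2sq ψ := fun ψ hψ =>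
    (hray ψ hψ).trans (mul_le_mul_of_nonneg_right hlt.le (l2sq_nonneg ψ))
  have h := finrank_le_dimBound hE W (fun ψ hψ => (hadm ψ hψ).1) hray'
  rw [hWk] at h
  linarith

/-- **Discreteness of the invariant-sector spectrum of Lüscher's matrix model (min–max form)**:
`μ_k^inv → ∞`.  This is the compactness half of `LuscherSimonGap`
(`= Tendsto physLevel atTop atTop ∧ 0 < luscherEps1`); Simon 1983, Cor. 4 ("`H₃` has discrete
spectrum") for `𝔞 = su(2)`, `ν = 3`, restricted to the colour-rotation-invariant sector.
[cite: SimonB1983DiscreteSpectrum, Cor. 4] [cite: Luscher1983, §1] -/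
theorem tendsto_physLevel_atTop : Tendsto physLevel atTop atTop := by
  refine tendsto_atTop_atTop.2 fun E => ⟨⌈dimBound (max E 0)⌉₊ + 1, fun k hk => ?_⟩
  refine (le_max_left E 0).trans (le_physLevel_of_dimBound_lt (le_max_right E 0) ?_)
  have h1 : dimBound (max E 0) ≤ (⌈dimBound (max E 0)⌉₊ : ℝ) := Nat.le_ceil _
  have h2 : ((⌈dimBound (max E 0)⌉₊ + 1 : ℕ) : ℝ) ≤ k := by exact_mod_cast hk
  push_cast at h2
  linarith

/-- `LuscherSimonGap` reduces to the simplicity of the invariant ground level. [cite: SimonB1983DiscreteSpectrum, Cor. 4] -/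
theorem luscherSimonGap_iff_eps1_pos : LuscherSimonGap ↔ 0 < luscherEps1 :=
  ⟨fun h => h.2, fun h => ⟨tendsto_physLevel_atTop, h⟩⟩

end Assembly

end Literature.Analysis.OperatorTheory.YMMatrixModel

end
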